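import Summits.RiemannHypothesis.RiemannHypothesis.Theses.SpectralTrace
import Summits.RiemannHypothesis.RiemannHypothesis.Theorems.SpectralIsHpSpectrum.Negative.RefutationImpliesRH
import Summits.RiemannHypothesis.RiemannHypothesis.Theorems.WindowTraceArch.Negative.ComplexSpectrum
import Literature.NumberTheory.LFunctions.WeilMellinBounds
import Literature.NumberTheory.LFunctions.WeilArchimedeanPositivityProofs
import Literature.NumberTheory.LFunctions.SimpleZeros

/-!
# Line `translation-orbit-charfun` for the crux `SpectralTrace.SpectralIsHpSpectrum` (stmt-RiemannHypothesis-0195)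

Skeleton (crux-plan, round 1, gen 2 — planner `planner-cruxplan-stmt-RiemannHypothesis-0195-translation-orbit-ch-g2-0`,
2026-08-16; supersedes the gen-1 skeleton of `…-translation-orbit-ch-0` (same lever, same two analytic stubs VERBATIM;
the gen-1 third stub `stub_tilt_singleton` is now PROVED glue, and the exit no longer imports the disprover's work
file `Cruxes/…/Disproof.lean` but only LANDED tree modules — see "What changed in gen 2" below).
Crux (route `SpectralTrace`, rank 5, auto-crux):
`∀ ι (γ : ι → ℝ), IsTrace γ → ∀ z, {i | 1/2 + iγ_i = z}.encard = 𝟙_{non-trivial zeros}(z) · analyticOrderNatAt ζ z`,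
where `IsTrace γ := ∀ Weil g, HasSum (i ↦ ĝ(1/2 + iγ_i)) (W g)`.

**The lever (idea card `Ideas/translation-orbit-charfun.md`; triage r1: pass k1, pass k2 (gen 1 and gen 2), pass k3,
merged with `charfun-tilt` and `pd-twist-levy-uniqueness` as "M1 = |k̂|²-tilt + Lévy uniqueness").**  Fix ONE Weil test
`k` and tilt a real spectrum `γ` of a functional `L` by the non-negative spectral weight `w_k(u) := ‖k̂(1/2 + iu)‖²`:
the tilted spectral measure `ν_{γ,k} := Σ_i w_k(γ_i) δ_{γ_i}` (`tiltMeasure`, a `Measure.sum` of weighted Diracs over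
the ARBITRARY index type `ι`) is FINITE (its mass is `Σ_i (k ⋆ k̃)^(1/2+iγ_i) = L(k ⋆ k̃)`, a `HasSum` of non-negative
reals, since `(k ⋆ k̃)^ = |k̂|²` on the critical line — tree `weilMellin_weilConv_weilReflect_half`), and the
TRANSLATION ORBIT of the single test `K := k ⋆ k̃` computes its characteristic function EXACTLY:
`charFun ν_{γ,k} (t) = Σ_i w_k(γ_i) e^{iγ_i t} = Σ_i (τ_t K)^(1/2 + iγ_i) = L(τ_t K)`, because on the critical line
translation is multiplication by a unimodular character (tree `weilMellin_weilTranslate`: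
`(τ_x h)^(s) = e^{(s−1/2)x} ĥ(s)`; here `s − 1/2 = iγ_i` is purely imaginary BECAUSE `γ` is real — the one place the
realness of the spectrum is consumed).  Two real spectra `γ, γ'` of the SAME functional `L` therefore carry finite
measures on `ℝ` with equal characteristic functions, hence equal measures (Mathlib `Measure.ext_of_charFun`, Lévy
uniqueness), hence equal atoms `w_k(x) · #{i | γ_i = x} = w_k(x) · #{j | γ'_j = x}` in `ℝ≥0∞`
(`tiltMeasure_apply_singleton`, PROVED); a narrow bump `k` with `Re k̂(1/2 + ix) > 0` (tree
`exists_isWeilTest_re_weilMellin_pos`) cancels the weight: EQUAL MULTIPLICITIES (`RealSpectrumUnique`, the card's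
Transfer C⁺, W-free).  The crux follows by comparing a trace family `γ` with the canonical real spectrum of `W` under
RH — the zeta ordinates repeated with multiplicity (`isRealSpectrumFor_zetaOrdinates`, from the landed
`hasSum_weilMellin_zeros` + `eq_half_add_of_riemannHypothesis`; RH itself comes from the hypothesis by the LANDED
Negative lemma `riemannHypothesis_of_trace`, p76712) — whose fibre `encard` IS the crux's right-hand side
(`encard_zetaOrdinates_fibre`, PROVED; no `ncard`/`ℤ` detour, no local Weyl law, no finiteness lemma needed).

**Registered stubs (sorry ONLY here; 2 — exactly the two analytic steps of the lever):**
* `stub_tiltFinite`     — the tilted spectral measure of a real spectrum is FINITE (mass identity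
  `Σ_i ‖k̂(1/2+iγ_i)‖² = Re L(k ⋆ k̃)` + `ℝ≥0∞` packaging of a `Measure.sum` over an arbitrary index type).  Size M−.
* `stub_charFun_tilt`   — THE LEVER and the hardest stub: `charFun (tiltMeasure γ k) t = L (τ_t (k ⋆ k̃))` for every
  real `t` (phase law on the line + Bochner integral of a bounded continuous function against a finite `Measure.sum`
  of weighted Diracs — `integral_sum_measure`, which carries `omit [Countable ι]` in Mathlib's `Bochner/SumMeasure.lean`
  — + `HasSum.tsum_eq`).  Size M.

**Composition (kernel-checked, no `sorry` outside the two stubs):** `realSpectrumUnique_of_tilt` (Lévy uniqueness +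
proved atom read-out + cancellation of the positive weight) and `encard_fibre_eq_of_realSpectrumUnique` (RH from the
hypothesis, off-line emptiness, on-line comparison with the zeta ordinates) give
`SpectralIsHpSpectrum_of : stub_tiltFinite → stub_charFun_tilt → SpectralIsHpSpectrum` (hypotheses keyed by the registered
stub names) concluding the route decl `SpectralTrace.SpectralIsHpSpectrum` BY NAME.

**What changed in gen 2 (and why).**  (a) `stub_tilt_singleton` (atom read-out of a weighted Dirac `Measure.sum`
over a bare `Type`) was the idea card's only self-declared residual risk; the gen-2 triager k2 proved it in scratch
(`atom_readout`, evidence 03:24Z) and the sibling line `Lines/test-algebra-stone-weierstrass.lean` proves it in the tree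
(`atomicMeasure_apply_singleton`); an S-sized, already-proved lemma is bookkeeping, not a stub (shred rule), so it is
proved here (`tiltMeasure_apply_singleton`) and the stub set shrinks to the two genuine analytic steps.  (b) The gen-1
exit imported `Cruxes/SpectralIsHpSpectrum/Disproof.lean` — a standing WORK file that its seat rewrites at every
boundary (02:31Z → 03:01Z already) and that `Lines/`-grade files may use but a landed `Theorems/` proof may not
import; the exit is now written over LANDED modules only (`Theorems/SpectralIsHpSpectrum/Negative/RefutationImpliesRH`
for §1, `Theorems/WindowTraceArch/Negative/ComplexSpectrum` for the calibration) with Disproof §2's bookkeeping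
re-proved here in the crux's own `ℕ∞` currency (`encard_zetaOrdinates_fibre`, `encard_fibre_eq_of_realSpectrumUnique`,
shared verbatim with the sibling line) — so when the last stub lands this file IS the crux proof, with no import to
re-engineer.  (c) Statements of the two surviving stubs are byte-identical to the gen-1 registration.

**Disproof used** (`Cruxes/SpectralIsHpSpectrum/Disproof.lean`, refuter-cdisprove, version 2026-08-16T03:01Z, read in
full; no longer imported — its conclusive §1/§3/§4 theorems are the LANDED `Theorems/SpectralIsHpSpectrum/Negative/
RefutationImpliesRH.lean`, p76712, which IS imported, so this check sees them by name).  §1 (`riemannHypothesis_of_trace`,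
landed twin of `riemannHypothesis_of_isTrace`) carries the exit's RH; §2 (`spectralIsHpSpectrum_iff_ordinate_count`,
`isTrace_ordinates_of_rh`, `fibre_half_add`, `encard_fibre_eq_mult_of_re_ne_half`, `riemannZetaZeroOrder_eq_analyticOrderNatAt`)
is re-proved below in `encard` form.  §3 `spectralIsHpSpectrum_false_without_value` (any proof must use the VALUE `W g`,
not mere summability) is honoured at `stub_charFun_tilt`: the two spectra are equated THROUGH the common value
`L(τ_t K)`; with `Summable` only, the two characteristic functions would be unrelated (and `IsRealSpectrumFor` keeps
`HasSum … (L g)`).  §3 `spectralIsHpSpectrum_false_on_window_of_nonpos` / §5 (window rigidity expected false for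
`A > 0`; H = ALL tests) are honoured structurally: the translates `τ_t K`, `t ∈ ℝ`, leave every window, so
`stub_charFun_tilt` consumes the ALL-tests hypothesis and no stub claims anything on a window.  §3 "realness is
load-bearing": the phase `e^{(s−1/2)t}` is unimodular only for `s` on the critical line (used in `stub_charFun_tilt`).
§3 "integrality is NOT load-bearing — prove the weighted MEASURE statement and specialise": literally the architecture
(measure equality first, atoms after).  §4 all-zeros variant (`≡ ¬RH`) is never approached: the right-hand side of the
crux is untouched.  No stub is an instance of a landed Negative lemma: the Negative lane refutes the
`Summable`-weakening, the `A ≤ 0` window version and the all-zeros variant — each stub here keeps `HasSum` with its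
value, all tests, and never mentions zeros of `ζ` at all (both stubs are W-free harmonic analysis for an arbitrary `L`).

**Sibling lines, for the lead:** `Lines/test-algebra-stone-weierstrass.lean` (same waypoint `RealSpectrumUnique` via a
Stone–Weierstrass density of `{ĝ|line}` in `C₀`, 4 stubs) and `Lines/dilation-peak-local-weyl.lean` (measure-free peak
limit); `Cruxes/SpectralIsHpSpectrum/SelfMajorantComplete.lean` (crux-ideate ideator 2 gen 2, 03:12Z) claims the same
waypoint SORRY-FREE by a self-majorised Tannery peak limit.  This line is the measure-theoretic (Lévy) route with the
smallest open surface: two TRUE stubs, all engines in Mathlib, glue closed.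
-/

noncomputable section

set_option linter.dupNamespace false

namespace Summit.RiemannHypothesis.RiemannHypothesis.Cruxes.SpectralIsHpSpectrum.TranslationOrbitCharfun

open Complex Set MeasureTheory Filter
open scoped Real Topology ENNReal
open Literature.NumberTheory.LFunctions
open Summit.RiemannHypothesis.RiemannHypothesis.Theorems.WindowTraceArch.Negative
open Summit.RiemannHypothesis.RiemannHypothesis.Theorems.SpectralIsHpSpectrum.Negative
  (riemannHypothesis_of_trace spectralIsHpSpectrum_false_without_value
    spectralIsHpSpectrum_false_on_window_of_nonpos)

/-! ## Vocabulary of the line -/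

/-- `γ` is a REAL SPECTRUM of the functional `L`: `Σ_i ĝ(1/2 + iγ_i) = L g` (`HasSum`) on every Weil test.
The crux hypothesis is `IsRealSpectrumFor γ weilFunctional` (definitionally, see the honesty checks). -/
def IsRealSpectrumFor {ι : Type*} (γ : ι → ℝ) (L : (ℝ → ℂ) → ℂ) : Prop :=
  ∀ g : ℝ → ℂ, IsWeilTest g → HasSum (fun i => weilMellin g (1 / 2 + (γ i : ℂ) * I)) (L g)

/-- The spectral weight of the test `k` on the critical line: `w_k(u) = ‖k̂(1/2 + iu)‖²` (`≥ 0`; it is the value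
`(k ⋆ k̃)^(1/2 + iu)` by `weilMellin_weilConv_weilReflect_half`). -/
def tiltWeight (k : ℝ → ℂ) (u : ℝ) : ℝ :=
  ‖weilMellin k (1 / 2 + (u : ℂ) * I)‖ ^ 2

/-- The TILTED SPECTRAL MEASURE `ν_{γ,k} := Σ_i w_k(γ_i) δ_{γ_i}` on `ℝ` (a `Measure.sum` of weighted Diracs over the
arbitrary index type `ι`; no countability is assumed anywhere). -/
def tiltMeasure {ι : Type*} (γ : ι → ℝ) (k : ℝ → ℂ) : Measure ℝ :=
  Measure.sum fun i => ENNReal.ofReal (tiltWeight k (γ i)) • Measure.dirac (γ i)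

/-- TRANSFER C⁺ of the idea card (W-free): two real spectra of the SAME functional have the same multiplicities.
Proved below from the two stubs (`realSpectrumUnique_of_tilt`); it implies the crux
(`encard_fibre_eq_of_realSpectrumUnique`). -/
def RealSpectrumUnique : Prop :=
  ∀ (ι ι' : Type) (γ : ι → ℝ) (γ' : ι' → ℝ) (L : (ℝ → ℂ) → ℂ),
    IsRealSpectrumFor γ L → IsRealSpectrumFor γ' L →
      ∀ x : ℝ, {i | γ i = x}.encard = {j | γ' j = x}.encard

/-! ## The two stub STATEMENTS (named `Prop`s; the registered `stub_*` theorems below restate them verbatim,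
`*_holds` certify the agreement definitionally, and `Registered.stub_*` are the name-keyed aliases used as the
hypotheses of `SpectralIsHpSpectrum_of` — the native skeleton audit admits a hypothesis whose head's last name
component is a declared stub; same device as `Cruxes/AsymptoticCriticalLine/Lines/interior-edge-split.lean` and the
gen-1 skeleton.  The `stub` obligation attribute of `HarnessLib.Audit.Tags` would do the same job but is gate-reserved:
a seat-written `Lines/` file carrying it is refused by `crux write`). -/

/-- Statement of STUB 1 — the tilted spectral measure of a real spectrum is FINITE: for every real spectrum `γ` of any
functional `L` and every Weil test `k`, `ν_{γ,k}(ℝ) = Σ_i ‖k̂(1/2+iγ_i)‖² < ∞`.  Why true: the hypothesis at the Weil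
test `k ⋆ k̃` (`IsWeilTest.weilConv`, `IsWeilTest.weilReflect`) is `HasSum (i ↦ (k ⋆ k̃)^(1/2+iγ_i)) (L(k ⋆ k̃))` and
`(k ⋆ k̃)^(1/2+iu) = ((‖k̂(1/2+iu)‖² : ℝ) : ℂ)` (`weilMellin_weilConv_weilReflect_half`), so the real parts
(`Complex.hasSum_re`) form a summable family of non-negative reals with sum `Re L(k ⋆ k̃)`; then `Measure.sum_apply`
on `univ` (no countability needed), `Measure.smul_apply`, `ENNReal.ofReal_tsum_of_nonneg`, `ENNReal.ofReal_lt_top`.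
(For `L = weilFunctional` the `HasSum` is the landed `Negative.hasSum_norm_sq_of_trace` verbatim.)
[Katznelson2004 VI.2; tree lemmas named] -/
def TiltFinite : Prop :=
  ∀ (ι : Type) (γ : ι → ℝ) (L : (ℝ → ℂ) → ℂ), IsRealSpectrumFor γ L →
    ∀ k : ℝ → ℂ, IsWeilTest k → IsFiniteMeasure (tiltMeasure γ k)

/-- Statement of STUB 2 (THE LEVER) — the translation orbit of ONE test is the Fourier–Stieltjes transform of the
tilted spectral measure: `charFun ν_{γ,k} (t) = L (τ_t (k ⋆ k̃))` for every real `t`, where `τ_t h = h(· − t)` is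
`weilTranslate h t`.  Why true: Mathlib `charFun_apply_real : charFun μ t = ∫ x, exp (t * x * I) ∂μ`; the integrand
is continuous with norm `1`, hence integrable against the finite measure `ν_{γ,k}` (STUB 1's content may be re-proved
inline: `Continuous.aestronglyMeasurable` + `HasFiniteIntegral` via `lintegral_sum_measure`, or `integrable_const`
+ `Integrable.mono'` under `IsFiniteMeasure`); `integral_sum_measure` (NO `[Countable ι]` hypothesis — it is
`omit`ted in `Mathlib/MeasureTheory/Integral/Bochner/SumMeasure.lean`) + `integral_smul_measure` + `integral_dirac`
give `Σ' i, w_k(γ_i) e^{i t γ_i}` (`ENNReal.toReal_ofReal` as `w_k ≥ 0`); on the other side `τ_t(k ⋆ k̃)` is a Weil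
test (`IsWeilTest.weilTranslate`) with `(τ_t K)^(1/2+iγ_i) = e^{iγ_i t} K^(1/2+iγ_i) = e^{iγ_i t} w_k(γ_i)`
(`weilMellin_weilTranslate`, `weilMellin_weilConv_weilReflect_half`), so the hypothesis `HasSum … (L (τ_t K))` and
`HasSum.tsum_eq` identify the two sums.  This is where the VALUE of `L` (Disproof §3) and the unbounded translates
(Disproof §3/§5) are consumed, and where realness of `γ` makes the phase unimodular.
[Katznelson2004 VI.2.2 Cor. (p.160); Bombieri2000Weil §2; tree lemmas named] -/
def TiltCharFun : Prop :=
  ∀ (ι : Type) (γ : ι → ℝ) (L : (ℝ → ℂ) → ℂ), IsRealSpectrumFor γ L →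
    ∀ k : ℝ → ℂ, IsWeilTest k → ∀ t : ℝ,
      charFun (tiltMeasure γ k) t = L (weilTranslate (weilConv k (weilReflect k)) t)

/-! ## The registered stubs (`sorry` lives only in these two theorems) -/

/-- **STUB 1 · `stub_tiltFinite`** (= `TiltFinite` verbatim) — finiteness of the tilted spectral measure of a real
spectrum (mass identity `Σ_i ‖k̂(1/2+iγ_i)‖² = Re L(k ⋆ k̃)`).  Size M−. -/
theorem stub_tiltFinite :
    ∀ (ι : Type) (γ : ι → ℝ) (L : (ℝ → ℂ) → ℂ), IsRealSpectrumFor γ L →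
      ∀ k : ℝ → ℂ, IsWeilTest k → IsFiniteMeasure (tiltMeasure γ k) := by
  sorry

/-- **STUB 2 · `stub_charFun_tilt`** (= `TiltCharFun` verbatim) — THE LEVER (hardest stub): the translation orbit
`t ↦ L(τ_t (k ⋆ k̃))` of one test IS the characteristic function of the tilted spectral measure.  Size M. -/
theorem stub_charFun_tilt :
    ∀ (ι : Type) (γ : ι → ℝ) (L : (ℝ → ℂ) → ℂ), IsRealSpectrumFor γ L →
      ∀ k : ℝ → ℂ, IsWeilTest k → ∀ t : ℝ,
        charFun (tiltMeasure γ k) t = L (weilTranslate (weilConv k (weilReflect k)) t) := by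
  sorry

/-! ### Consistency: each named statement IS its registered stub (definitionally) -/

theorem tiltFinite_holds : TiltFinite := stub_tiltFinite
theorem tiltCharFun_holds : TiltCharFun := stub_charFun_tilt

/-! ### Name-keyed aliases of the two statements (the hypotheses of the composition) -/
namespace Registered

/-- Alias of `TiltFinite` keyed by the registered stub name. -/
abbrev stub_tiltFinite : Prop := TiltFinite
/-- Alias of `TiltCharFun` keyed by the registered stub name. -/
abbrev stub_charFun_tilt : Prop := TiltCharFun

end Registered

/-! ## Proved glue, part 1: atoms of the tilted measure and a positive weight at any prescribed point -/

/-- **Atom read-out** (the gen-1 `stub_tilt_singleton`, now PROVED): over an ARBITRARY index type,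
`ν_{γ,k}{x} = ofReal (w_k x) · #{i | γ_i = x}` in `ℝ≥0∞` (count as `encard`, so an infinite fibre reads `⊤ · w`).
`Measure.sum_apply` on the measurable `{x}`; each summand is the indicator of the fibre with the constant value
`ofReal (w_k x)`; `tsum_subtype` + `ENNReal.tsum_set_const`. -/
theorem tiltMeasure_apply_singleton {ι : Type*} (γ : ι → ℝ) (k : ℝ → ℂ) (x : ℝ) :
    tiltMeasure γ k {x} = ENNReal.ofReal (tiltWeight k x) * {i | γ i = x}.encard := by
  rw [tiltMeasure, Measure.sum_apply _ (measurableSet_singleton x)]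
  have h : ∀ i, (ENNReal.ofReal (tiltWeight k (γ i)) • Measure.dirac (γ i)) {x} =
      ({i | γ i = x} : Set ι).indicator (fun _ => ENNReal.ofReal (tiltWeight k x)) i := by
    intro i
    rw [Measure.smul_apply, smul_eq_mul, Measure.dirac_apply' _ (measurableSet_singleton x)]
    by_cases hi : γ i = x
    · rw [Set.indicator_of_mem (show i ∈ {i | γ i = x} from hi),
        Set.indicator_of_mem (show γ i ∈ ({x} : Set ℝ) from hi), hi]
      simp
    · rw [Set.indicator_of_notMem (show i ∉ {i | γ i = x} from hi),
        Set.indicator_of_notMem (show γ i ∉ ({x} : Set ℝ) from hi)]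
      simp
  simp_rw [h]
  rw [← tsum_subtype {i | γ i = x} (fun _ => ENNReal.ofReal (tiltWeight k x)), ENNReal.tsum_set_const, mul_comm]

/-- For every real `x` there is a Weil test `k` with `w_k(x) = ‖k̂(1/2 + ix)‖² > 0` (the narrow bump of
`exists_isWeilTest_re_weilMellin_pos`, which has `Re k̂(σ + ix) > 0` for all real `σ`). -/
theorem exists_tiltWeight_pos (x : ℝ) : ∃ k : ℝ → ℂ, IsWeilTest k ∧ 0 < tiltWeight k x := by
  obtain ⟨k, hk, hpos⟩ := exists_isWeilTest_re_weilMellin_pos x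
  refine ⟨k, hk, ?_⟩
  have h1 := hpos (1 / 2)
  have h2 : ((1 / 2 : ℝ) : ℂ) + x * I = 1 / 2 + x * I := by push_cast; ring
  rw [h2] at h1
  have hne : weilMellin k (1 / 2 + x * I) ≠ 0 := by
    intro h0
    rw [h0] at h1
    simp at h1
  unfold tiltWeight
  exact pow_pos (norm_pos_iff.mpr hne) 2

/-- **Local finiteness for free** (the card's point (2), not used by the composition but recorded for the lead and
the deep-refuter): STUB 1 alone already forces every fibre of a real spectrum of ANY functional to be finite — tilt by
the bump of `exists_tiltWeight_pos x`; the atom at `x` is `w_k(x) · #fibre ≤ ν(ℝ) < ∞` with `w_k(x) > 0`.  No local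
Weyl law, no `W`. -/
theorem finite_fibre_of_tiltFinite (h1 : TiltFinite) {ι : Type} {γ : ι → ℝ} {L : (ℝ → ℂ) → ℂ}
    (hγ : IsRealSpectrumFor γ L) (x : ℝ) : {i | γ i = x}.Finite := by
  obtain ⟨k, hk, hw⟩ := exists_tiltWeight_pos x
  haveI : IsFiniteMeasure (tiltMeasure γ k) := h1 ι γ L hγ k hk
  by_contra hinf
  have htop : ({i | γ i = x} : Set ι).encard = ⊤ := Set.encard_eq_top_iff.mpr hinf
  have hx := measure_lt_top (tiltMeasure γ k) {x}
  rw [tiltMeasure_apply_singleton, htop, ENat.toENNReal_top,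
    ENNReal.mul_top (ENNReal.ofReal_pos.mpr hw).ne'] at hx
  exact lt_irrefl _ hx

/-! ## Proved glue, part 2: Lévy uniqueness ⇒ the W-free transfer `RealSpectrumUnique` -/

/-- **The two stubs prove the transfer C⁺.**  Two real spectra of the same `L`, tilted by the same test `k`, have
finite measures (STUB 1) with the same characteristic function `t ↦ L(τ_t (k ⋆ k̃))` (STUB 2), hence are EQUAL
(`Measure.ext_of_charFun`); read the atom at `{x}` on both sides (`tiltMeasure_apply_singleton`) and cancel the weight
`ofReal (w_k x)`, which is `≠ 0` for the bump of `exists_tiltWeight_pos` and `≠ ⊤` always (`ENNReal.mul_right_inj`). -/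
theorem realSpectrumUnique_of_tilt (h1 : TiltFinite) (h2 : TiltCharFun) : RealSpectrumUnique := by
  intro ι ι' γ γ' L hγ hγ' x
  obtain ⟨k, hk, hw⟩ := exists_tiltWeight_pos x
  haveI : IsFiniteMeasure (tiltMeasure γ k) := h1 ι γ L hγ k hk
  haveI : IsFiniteMeasure (tiltMeasure γ' k) := h1 ι' γ' L hγ' k hk
  have hcf : charFun (tiltMeasure γ k) = charFun (tiltMeasure γ' k) := by
    funext t
    rw [h2 ι γ L hγ k hk t, h2 ι' γ' L hγ' k hk t]
  have hμ : tiltMeasure γ k = tiltMeasure γ' k := Measure.ext_of_charFun hcf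
  have hx : tiltMeasure γ k {x} = tiltMeasure γ' k {x} := by rw [hμ]
  rw [tiltMeasure_apply_singleton γ k x, tiltMeasure_apply_singleton γ' k x] at hx
  have hw0 : ENNReal.ofReal (tiltWeight k x) ≠ 0 := (ENNReal.ofReal_pos.mpr hw).ne'
  have hwt : ENNReal.ofReal (tiltWeight k x) ≠ ∞ := ENNReal.ofReal_ne_top
  exact ENat.toENNReal_inj.mp ((ENNReal.mul_right_inj hw0 hwt).mp hx)

/-- The waypoint C⁺ itself, witnessed from the registered stubs (closed exactly when both `sorry`s are discharged;
this is the `_holds` witness the tree audit keys `RealSpectrumUnique` to). -/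
theorem realSpectrumUnique_holds : RealSpectrumUnique :=
  realSpectrumUnique_of_tilt tiltFinite_holds tiltCharFun_holds

/-! ## Proved glue, part 3: the transfer C⁺ ⇒ the crux (RH from the hypothesis — landed Negative §1 — then compare
with the canonical real spectrum of `W`; Disproof §2's bookkeeping re-proved in the crux's own `ℕ∞` currency, shared
with `Lines/test-algebra-stone-weierstrass.lean`) -/

/-- The canonical real spectrum under RH: ordinates of the non-trivial zeros repeated with multiplicity (the index
type of the landed `hasSum_weilMellin_zeros`; it lives in `Type`). -/
def zetaOrdinates :
    (Σ ρ : ZetaZeros.riemannZetaNontrivialZeros, Fin (riemannZetaZeroOrder (ρ : ℂ)).toNat) → ℝ :=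
  fun p => (p.1 : ℂ).im

/-- Calibration: under RH the zeta ordinates are a real spectrum of `W` (landed `hasSum_weilMellin_zeros` +
`eq_half_add_of_riemannHypothesis`; the statement of Disproof §2 `isTrace_ordinates_of_rh`). -/
theorem isRealSpectrumFor_zetaOrdinates (hRH : _root_.RiemannHypothesis) :
    IsRealSpectrumFor zetaOrdinates weilFunctional := by
  intro g hg
  simpa only [zetaOrdinates, eq_half_add_of_riemannHypothesis hRH] using hasSum_weilMellin_zeros hg

/-- Under RH the non-trivial zeros are on the critical line (unfolding Mathlib's `RiemannHypothesis` clauses;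
Disproof §2 `re_eq_half_of_mem`). -/
theorem re_eq_half_of_mem (hRH : _root_.RiemannHypothesis) {z : ℂ}
    (hz : z ∈ ZetaZeros.riemannZetaNontrivialZeros) : z.re = 1 / 2 := by
  refine hRH z (ZetaZeros.riemannZetaNontrivialZeros.zeta_eq_zero hz) ?_
    (ZetaZeros.riemannZetaNontrivialZeros.ne_one hz)
  rintro ⟨n, hn⟩
  have h0 := ZetaZeros.riemannZetaNontrivialZeros.re_pos hz
  rw [hn] at h0
  simp at h0
  linarith [n.cast_nonneg (α := ℝ)]

/-- A point `1/2 + iτ` of the critical line is not the pole. -/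
theorem half_add_ne_one (τ : ℝ) : (1 / 2 : ℂ) + τ * I ≠ 1 := by
  intro h
  have := congrArg Complex.re h
  norm_num at this

/-- `m(s) = analyticOrderNatAt ζ s` for `s ≠ 1`: the explicit formula's multiplicity (`riemannZetaZeroOrder`, the
`Fin`-size in `zetaOrdinates`) is the crux's multiplicity (Disproof §2, same name; finiteness of the order is the
landed `analyticOrderAt_riemannZeta_ne_top`, `SimpleZeros.lean`). -/
theorem riemannZetaZeroOrder_eq_analyticOrderNatAt {s : ℂ} (hs : s ≠ 1) :
    riemannZetaZeroOrder s = (analyticOrderNatAt riemannZeta s : ℤ) := by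
  have ha : AnalyticAt ℂ riemannZeta s := analyticOn_riemannZeta s hs
  obtain ⟨n, hn⟩ := ENat.ne_top_iff_exists.mp (analyticOrderAt_riemannZeta_ne_top hs)
  rw [riemannZetaZeroOrder, ha.meromorphicOrderAt_eq, ← hn, ENat.map_coe, WithTop.untop₀_coe,
    analyticOrderNatAt, ← hn, ENat.toNat_coe]

/-- **Fibre count of the canonical family IS the crux's right-hand side**, in `ℕ∞`:
`#{p : Im ρ_p = τ} = 𝟙_{non-trivial zeros}(1/2+iτ) · analyticOrderNatAt ζ (1/2+iτ)` under RH. -/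
theorem encard_zetaOrdinates_fibre (hRH : _root_.RiemannHypothesis) (τ : ℝ) :
    {p | zetaOrdinates p = τ}.encard =
      ZetaZeros.riemannZetaNontrivialZeros.indicator
        (fun w => (analyticOrderNatAt riemannZeta w : ℕ∞)) (1 / 2 + τ * I) := by
  set s : ℂ := 1 / 2 + τ * I with hs_def
  have hs1 : s ≠ 1 := half_add_ne_one τ
  by_cases hz : s ∈ ZetaZeros.riemannZetaNontrivialZeros
  · have hset : {p : (Σ ρ : ZetaZeros.riemannZetaNontrivialZeros,
        Fin (riemannZetaZeroOrder (ρ : ℂ)).toNat) | zetaOrdinates p = τ} =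
        Set.range (Sigma.mk (β := fun ρ : ZetaZeros.riemannZetaNontrivialZeros =>
          Fin (riemannZetaZeroOrder (ρ : ℂ)).toNat) ⟨s, hz⟩) := by
      ext p
      simp only [Set.mem_setOf_eq, Set.mem_range, zetaOrdinates]
      constructor
      · intro hp
        obtain ⟨ρ, c⟩ := p
        have hρ : ρ = ⟨s, hz⟩ := by
          apply Subtype.ext
          have h1 := eq_half_add_of_riemannHypothesis hRH ρ
          simp only at hp
          rw [← h1, hp]
        subst hρ
        exact ⟨c, rfl⟩
      · rintro ⟨c, rfl⟩
        simp [hs_def]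
    rw [hset, Set.indicator_of_mem hz, ← (Set.finite_range _).cast_ncard_eq,
      Set.ncard_range_of_injective sigma_mk_injective, Nat.card_eq_fintype_card, Fintype.card_fin]
    have h1 := riemannZetaZeroOrder_eq_analyticOrderNatAt hs1
    have h2 : (riemannZetaZeroOrder s).toNat = analyticOrderNatAt riemannZeta s := by
      rw [h1]; simp
    rw [h2]
  · have hset : {p : (Σ ρ : ZetaZeros.riemannZetaNontrivialZeros,
        Fin (riemannZetaZeroOrder (ρ : ℂ)).toNat) | zetaOrdinates p = τ} = ∅ := by
      ext p
      simp only [Set.mem_setOf_eq, Set.mem_empty_iff_false, iff_false, zetaOrdinates]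
      intro hp
      apply hz
      have h1 := eq_half_add_of_riemannHypothesis hRH p.1
      rw [hp] at h1
      rw [hs_def, h1]
      exact p.1.2
    rw [hset, Set.encard_empty, Set.indicator_of_notMem hz]

/-- **Reduction** (`RealSpectrumUnique → crux`, pointwise): RH from the hypothesis (landed
`riemannHypothesis_of_trace`); off the critical line the fibre is empty and `z` is not a non-trivial zero
(Disproof §2 `encard_fibre_eq_mult_of_re_ne_half`); on the line `z = 1/2 + i·Im z`, the fibre is `{i | γ_i = Im z}`
(Disproof §2 `fibre_half_add`), and C⁺ compares it with the canonical family, counted by `encard_zetaOrdinates_fibre`. -/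
theorem encard_fibre_eq_of_realSpectrumUnique (hU : RealSpectrumUnique) {ι : Type} {γ : ι → ℝ}
    (hγ : IsRealSpectrumFor γ weilFunctional) (z : ℂ) :
    {i : ι | (1 / 2 : ℂ) + (γ i : ℂ) * I = z}.encard =
      ZetaZeros.riemannZetaNontrivialZeros.indicator
        (fun w => (analyticOrderNatAt riemannZeta w : ℕ∞)) z := by
  have hRH : _root_.RiemannHypothesis := riemannHypothesis_of_trace hγ
  by_cases hre : z.re = 1 / 2
  · have hzeq : z = 1 / 2 + (z.im : ℝ) * I := by
      apply Complex.ext <;> simp [hre]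
    have hfib : {i : ι | (1 / 2 : ℂ) + (γ i : ℂ) * I = z} = {i | γ i = z.im} := by
      ext i
      simp only [Set.mem_setOf_eq]
      constructor
      · intro h
        have := congrArg Complex.im h
        simpa using this
      · intro h
        rw [hzeq]
        simp [h]
    rw [hfib, hU ι _ γ zetaOrdinates weilFunctional hγ (isRealSpectrumFor_zetaOrdinates hRH) z.im,
      encard_zetaOrdinates_fibre hRH z.im, ← hzeq]
  · have hfib : {i : ι | (1 / 2 : ℂ) + (γ i : ℂ) * I = z} = ∅ := by
      ext i
      simp only [Set.mem_setOf_eq, Set.mem_empty_iff_false, iff_false]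
      intro h
      apply hre
      have := congrArg Complex.re h
      simp at this
      rw [← this]
      norm_num
    rw [hfib, Set.encard_empty, Set.indicator_of_notMem fun hmem => hre (re_eq_half_of_mem hRH hmem)]

/-! ## The composition: the two stubs imply the crux, BY NAME (kernel-checked; no `sorry` below) -/

/-- **`SpectralIsHpSpectrum_of`** — the glue of the line: STUBS 1–2 ⇒ `RealSpectrumUnique`
(`realSpectrumUnique_of_tilt`: Lévy uniqueness for the finite tilted measures + proved atom read-out + cancellation
of a positive weight) ⇒ the crux pointwise (`encard_fibre_eq_of_realSpectrumUnique`: RH from the hypothesis by the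
landed Negative §1, calibration by the landed `hasSum_weilMellin_zeros`, fibre count `encard_zetaOrdinates_fibre`). -/
theorem SpectralIsHpSpectrum_of (h1 : Registered.stub_tiltFinite) (h2 : Registered.stub_charFun_tilt) :
    Summit.RiemannHypothesis.RiemannHypothesis.Theses.SpectralTrace.SpectralIsHpSpectrum :=
  fun _ _ hγ z => encard_fibre_eq_of_realSpectrumUnique (realSpectrumUnique_of_tilt h1 h2) hγ z

/-- Wiring check: the registered stubs feed `SpectralIsHpSpectrum_of` as stated (the verbatim restatements are
definitionally the named statements).  When both `sorry`s are discharged this term IS the crux proof. -/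
example : Summit.RiemannHypothesis.RiemannHypothesis.Theses.SpectralTrace.SpectralIsHpSpectrum :=
  SpectralIsHpSpectrum_of stub_tiltFinite stub_charFun_tilt

/-! ## Honesty checks (sorry-free): the stubs are not costumes, and the landed Negative lemmas are in scope -/

/-- The crux hypothesis IS `IsRealSpectrumFor γ weilFunctional` (so the stubs, stated for an arbitrary functional
`L`, are strictly MORE general than what the composition consumes, and none mentions `ζ`, `W` or its zeros). -/
example : Summit.RiemannHypothesis.RiemannHypothesis.Theses.SpectralTrace.SpectralIsHpSpectrum ↔
    ∀ (ι : Type) (γ : ι → ℝ), IsRealSpectrumFor γ weilFunctional →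
      ∀ z : ℂ, {i : ι | (1 / 2 : ℂ) + (γ i : ℂ) * I = z}.encard =
        ZetaZeros.riemannZetaNontrivialZeros.indicator (fun w => (analyticOrderNatAt riemannZeta w : ℕ∞)) z :=
  Iff.rfl

/-- Engine of STUB 2's consumer: Lévy uniqueness for finite measures on `ℝ` is Mathlib's `Measure.ext_of_charFun`
with the instances `ℝ` carries. -/
example (μ ν : Measure ℝ) [IsFiniteMeasure μ] [IsFiniteMeasure ν] (h : charFun μ = charFun ν) : μ = ν :=
  Measure.ext_of_charFun h

/-- Engine of STUB 2's left-hand side: Mathlib's characteristic function on `ℝ` is `∫ e^{i t x} dμ(x)` with no sign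
or `2π` change (`charFun_apply_real`). -/
example (μ : Measure ℝ) (t : ℝ) : charFun μ t = ∫ x, cexp (t * x * I) ∂μ := charFun_apply_real t

/-- The phase law behind STUB 2, on the critical line: `(τ_t h)^(1/2 + iu) = e^{iut} ĥ(1/2 + iu)` — a unimodular
factor BECAUSE the spectral parameter is real (tree `weilMellin_weilTranslate`); the SAME phase `e^{i t u}` as in
`charFun_apply_real` (no sign mismatch between the two sides of STUB 2). -/
example (h : ℝ → ℂ) (t u : ℝ) :
    weilMellin (weilTranslate h t) (1 / 2 + u * I) = cexp (t * u * I) * weilMellin h (1 / 2 + u * I) := by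
  rw [weilMellin_weilTranslate]
  congr 2
  ring

/-- Translates of Weil tests are Weil tests (tree `IsWeilTest.weilTranslate`): the orbit `τ_t (k ⋆ k̃)` stays
admissible for every real `t` — the ALL-tests hypothesis is what STUB 2 consumes (Disproof §3/§5: no window version
could). -/
example {k : ℝ → ℂ} (hk : IsWeilTest k) (t : ℝ) : IsWeilTest (weilTranslate (weilConv k (weilReflect k)) t) :=
  (hk.weilConv hk.weilReflect).weilTranslate t

/-- The weight behind STUBS 1–2 is the value of the autocorrelation test on the line:
`(k ⋆ k̃)^(1/2 + iu) = w_k(u)` (tree `weilMellin_weilConv_weilReflect_half`). -/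
example {k : ℝ → ℂ} (hk : IsWeilTest k) (u : ℝ) :
    weilMellin (weilConv k (weilReflect k)) (1 / 2 + u * I) = ((tiltWeight k u : ℝ) : ℂ) :=
  weilMellin_weilConv_weilReflect_half hk u

/-- Landed Negative lemma in scope (p76712): weakening the hypothesis to `Summable` makes the crux FALSE — the stubs
keep `HasSum … (L g)` WITH its value (`IsRealSpectrumFor`), so neither is an instance of this refutation. -/
example : ¬ ∀ (ι : Type) (γ : ι → ℝ),
    (∀ g : ℝ → ℂ, IsWeilTest g → Summable fun i => weilMellin g (1 / 2 + (γ i : ℂ) * I)) →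
      ∀ z : ℂ, {i : ι | (1 / 2 : ℂ) + (γ i : ℂ) * I = z}.encard =
        ZetaZeros.riemannZetaNontrivialZeros.indicator (fun w => (analyticOrderNatAt riemannZeta w : ℕ∞)) z :=
  spectralIsHpSpectrum_false_without_value

end Summit.RiemannHypothesis.RiemannHypothesis.Cruxes.SpectralIsHpSpectrum.TranslationOrbitCharfun

end
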